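import Summits.QuantumFields.BalabanUV.T4Continuum.Support.NE3ExactLineSumsTower
import Summits.QuantumFields.BalabanUV.T4Continuum.Support.NE3CovariantLineAdjointFrame
import Summits.QuantumFields.BalabanUV.T4Continuum.Support.AveragingDeficitBlockDensitySeg
import HarnessLib

/-!
# T⁴ programme, node NE3, route H♮ · row K4-0 (file 1) — THE STRAIGHT COVARIANT BLOCK-LINE AVERAGE AS A COPY SUM:
# `Qstr L W η z κ = Ad (cavg L W z κ)⁻¹ (Σ_r Σ_{i<L} L^{−d}•Ad (W(Γ_{q,q+r})·W([q+r, q+r+(i+1)e_κ])) (η (q+r+i•e_κ) κ))` — the END-framed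
# reading of the START-corner copy sum (located convention point C-ne3leaf04g5-2, HOME/CLAIMS.log l.18557)

NE3 formalisation swarm `b2b-balaban-t4-ne3-formalise-*`, LEAF PROVER 04 (gen 5), row **K4-0** of the owner's SHAPE K4 (HOME/CLAIMS.log l.17848,
«`‖SW − QstrIter‖` … leaf-04 natural»), INTENT l.18532, corrected SHAPE l.18587 after the located convention point C-ne3leaf04g5-2 (l.18557):
this lineage's straight covariant block-line average `NE3CovariantLineSums.Qstr` (C1) reads the block's line copies in the frame at the END
of the averaged coarse bond (`Ad V̄(c)⁻¹`), leaf-03-g7's single-scale comb line sum `NE3CovariantLineAdjointFrame.TWc` (K4-a, p228795) at the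
START corner.  FILE 1 (this file, exact kinematics at EVERY background, 0 def): §1 the one-level copy sum and the ONE frame factor; §2 one level
down the tower the coarse copy's own-bond factor CANCELS (so in `QstrIter` exactly one, top-level, frame factor survives).  Files 2–3 (SF:
the path-mismatch series vs `TWc`, k-free and top-dominated; the comparison `‖M^{−d}•TWc − Ad (cavgIter L k W z κ) (QstrIter …)‖`) follow.

HONEST: kinematics on OUR frame (bookkeeping identities); nothing about Bałaban's minimisers; (P♮)_W, (ML_w) at W ≠ 1, T-E_w, NE3 NOT proved;
spine PROVED 0∕9; finite T⁴ rung (B)+1 — NOT infinite volume, NOT mass gap, NOT BetaPertH, NOT Clay.  PLACEMENT: `Summits/QuantumFields/BalabanUV/`.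
-/

set_option autoImplicit false

open scoped BigOperators Matrix.Norms.L2Operator
open Finset

namespace Summit.QuantumFields.BalabanUV.T4Continuum.NE3CombVsTowerLineSums

open Literature.MathematicalPhysics.QuantumFieldTheory.Balaban1983to89
open B7Prop1Explicit B7Prop2Explicit
open T4AveragingDeficitWall (IsUnitaryCfg SmallField Ad)
open T4AveragingDeficitNonAbelian (Ad_mul)
open AveragingDeficitNearIdentity (Ad_sum Ad_real_smul)
open AveragingDeficitTransport (dhol)
open AveragingDeficitChartCalculus (cavg)
open BlockAverageDbarLinBound (segMain)
open NE3CovariantLineSums (Qstr)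
open AveragingDeficitBlockDensitySeg (dhol_seg_eq_sum)

noncomputable section

variable {d : ℕ} {n : Type*} [Fintype n] [DecidableEq n]

/-! ## §1 One level: `Qstr` is the end-framed copy sum -/

/-- **THE START-CORNER COPY SUM**: `segMain L W η q κ = Σ_r Σ_{i<L} L^{−d}•Ad (W(Γ_{q,q+r})·W([q+r, q+r+(i+1)e_κ])) (η (q+r+i•e_κ) κ)` — every
fine copy carried to the corner `q` by the holonomy of tree·segment up to and including its own bond. [folklore] -/
theorem segMain_eq_copySum (L : ℕ) (W : Site d → Fin d → (Matrix n n ℂ)ˣ) (η : Site d → Fin d → Matrix n n ℂ) (q : Site d) (κ : Fin d) :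
    segMain L W η q κ = ∑ r : Fin d → Fin L, ∑ i ∈ range L, (((L : ℝ) ^ d)⁻¹) •
      Ad (hol W q (treeWord (boxVec L r)) * hol W (q + boxVec L r) (seg κ ((i + 1 : ℕ) : ℤ)))
        (η (q + boxVec L r + (i : ℤ) • e κ) κ) := by
  unfold segMain
  refine Finset.sum_congr rfl fun r _ => ?_
  rw [dhol_seg_eq_sum, Ad_sum, Finset.smul_sum]
  exact Finset.sum_congr rfl fun i _ => by rw [← Ad_mul]

/-- **`Qstr` IS THE END-FRAMED COPY SUM**: `Qstr L W η z κ = Ad (cavg L W z κ)⁻¹ (copy sum at the corner L•z)` — the ONE frame factor of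
the located convention point (at the next level it cancels against the transport «including the own bond»). [folklore] -/
theorem Qstr_eq_Ad_copySum (L : ℕ) (W : Site d → Fin d → (Matrix n n ℂ)ˣ) (η : Site d → Fin d → Matrix n n ℂ) (z : Site d) (κ : Fin d) :
    Qstr L W η z κ = Ad (cavg L W z κ)⁻¹ (∑ r : Fin d → Fin L, ∑ i ∈ range L, (((L : ℝ) ^ d)⁻¹) •
      Ad (hol W ((L : ℤ) • z) (treeWord (boxVec L r)) * hol W ((L : ℤ) • z + boxVec L r) (seg κ ((i + 1 : ℕ) : ℤ)))
        (η ((L : ℤ) • z + boxVec L r + (i : ℤ) • e κ) κ)) := by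
  unfold Qstr cavg
  rw [segMain_eq_copySum]

/-- … and conjugating back: `Ad (cavg L W z κ) (Qstr L W η z κ)` = the start-corner copy sum. [folklore] -/
theorem Ad_cavg_Qstr_eq_copySum (L : ℕ) (W : Site d → Fin d → (Matrix n n ℂ)ˣ) (η : Site d → Fin d → Matrix n n ℂ) (z : Site d)
    (κ : Fin d) :
    Ad (cavg L W z κ) (Qstr L W η z κ) = ∑ r : Fin d → Fin L, ∑ i ∈ range L, (((L : ℝ) ^ d)⁻¹) •
      Ad (hol W ((L : ℤ) • z) (treeWord (boxVec L r)) * hol W ((L : ℤ) • z + boxVec L r) (seg κ ((i + 1 : ℕ) : ℤ)))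
        (η ((L : ℤ) • z + boxVec L r + (i : ℤ) • e κ) κ) := by
  rw [Qstr_eq_Ad_copySum, NE3GaugeDirFrames.Ad_Ad_inv]

/-! ## §2 One level down: the coarse copy's own-bond frame CANCELS -/

/-- **THE CANCELLATION**: reading the coarse field `Qstr L W η` through the next level's start-corner copy sum (background `cavg L W`),
the coarse copy `c₁ = (L•z + r + i•e_κ, κ)` is transported by the coarse tree·segment UP TO THE START of `c₁` only — its own averaged
bond `V̄(c₁)` (the «including the own bond» factor of the copy sum) cancels `Qstr`'s end-frame `Ad V̄(c₁)⁻¹`: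
`Σ_{r,i} L^{−d}•Ad (hol V̄ (L•z) (treeWord r) · hol V̄ (L•z+r) (seg κ (i+1))) (Qstr L W η (L•z+r+i•e_κ) κ)
 = Σ_{r,i} L^{−d}•Ad (hol V̄ (L•z) (treeWord r) · hol V̄ (L•z+r) (seg κ i)) (Ad (cavg L W (L•z+r+i•e_κ) κ) (Qstr L W η (L•z+r+i•e_κ) κ))`,
`V̄ = cavg L W` — EXACT at every background. [folklore] -/
theorem copySum_Qstr_cancel (L : ℕ) (W : Site d → Fin d → (Matrix n n ℂ)ˣ) (η : Site d → Fin d → Matrix n n ℂ) (z : Site d) (κ : Fin d) :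
    ∑ r : Fin d → Fin L, ∑ i ∈ range L, (((L : ℝ) ^ d)⁻¹) •
      Ad (hol (cavg L W) ((L : ℤ) • z) (treeWord (boxVec L r)) * hol (cavg L W) ((L : ℤ) • z + boxVec L r) (seg κ ((i + 1 : ℕ) : ℤ)))
        (Qstr L W η ((L : ℤ) • z + boxVec L r + (i : ℤ) • e κ) κ)
    = ∑ r : Fin d → Fin L, ∑ i ∈ range L, (((L : ℝ) ^ d)⁻¹) •
      Ad (hol (cavg L W) ((L : ℤ) • z) (treeWord (boxVec L r)) * hol (cavg L W) ((L : ℤ) • z + boxVec L r) (seg κ (i : ℤ)))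
        (Ad (cavg L W ((L : ℤ) • z + boxVec L r + (i : ℤ) • e κ) κ) (Qstr L W η ((L : ℤ) • z + boxVec L r + (i : ℤ) • e κ) κ)) := by
  refine Finset.sum_congr rfl fun r _ => Finset.sum_congr rfl fun i _ => ?_
  rw [show ((i + 1 : ℕ) : ℤ) = (i : ℤ) + 1 by push_cast; ring, hol_seg_succ, ← mul_assoc, Ad_mul]

/-- … and with §1: the coarse copy read at its START frame is the fine START-corner copy sum of its own block,
`Ad (cavg L W y κ) (Qstr L W η y κ) = copy sum at L•y` — so two levels of the tower read every fine copy through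
(coarse tree · coarse segment up to the start of the coarse copy) · (fine tree · fine segment including the own fine bond). [folklore] -/
theorem Ad_cavg_Qstr_eq_copySum' (L : ℕ) (W : Site d → Fin d → (Matrix n n ℂ)ˣ) (η : Site d → Fin d → Matrix n n ℂ) (y : Site d)
    (κ : Fin d) :
    Ad (cavg L W y κ) (Qstr L W η y κ) = segMain L W η ((L : ℤ) • y) κ := by
  unfold Qstr cavg
  rw [NE3GaugeDirFrames.Ad_Ad_inv]

end

end Summit.QuantumFields.BalabanUV.T4Continuum.NE3CombVsTowerLineSums
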